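import Summits.QuantumFields.YangMills.Theorems.RationalShortRootRigidityNoU3Algebra
import Summits.QuantumFields.YangMills.Theorems.RationalShortRootRigidityRealRootedLimit
import HarnessLib

/-!
# `RationalShortRootRigidity` — Step (2d) helpers for the no-`u₃` lemma (m9), part II: the integer-exponent rescaling

Helper lemmas INSIDE the paper proof of crux `stmt-QuantumFields-23124` (`F4SubCurvatureDoor.RationalShortRootRigidity`,
LINE g15-A of planner ym-idea-3; Step (2d) = free-hands menu III item (m9) `Helpers.NoU3Lemma`, owner's Lean plan
HOME l15/STUB-PLAN-NoU3Lemma.md §1).  Given the critical ratio `a/b` (`3a < 2b`) and the maximality `j·b ≤ a·(k−i)` on the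
support `S'`, the substitution `y = s^b`, `z = W·s^{3a}` turns `Q_y(z) = Σ c_ij z^i (3zy − 4y³)^j` into `s^{3ak}·P_s(W)` where
the coefficients of `P_s` are constants times NON-POSITIVE INTEGER powers of `s` (`rescaled_identity`; exponent bookkeeping
`noU3_exponent_le`); `P_s` has degree exactly `k` (`natDegree_rescaled`), only real roots when every `Q_y` has
(`rescaled_roots_real`), and converges coefficientwise along `s = N+1` to the «top-weight» polynomial
`Σ_{j b = a(k−i)} c_ij (−4)^j W^i` (`tendsto_coeff_rescaled`); by `realRootedLimit` (p664233) and
`card_roots_eq_natDegree_of_roots_real` (p666655) the top-weight polynomial has only real roots (`topWeight_roots_real`).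

Mathlib + the two tree files above; THEOREMS ONLY (no definitions); no named facts; no `sorry`; default heartbeats.  Nothing
about the crux 23124, the route's rung or the Yang–Mills mass gap is proved here; (m9) itself is NOT proved by this file.
Free-hands seat `ym-line-frs-p2` g10, `--supports stmt-QuantumFields-23124`.
-/

set_option autoImplicit false

namespace Summit.QuantumFields.YangMills.Theorems.RationalShortRootRigidity

open Filter Topology Polynomial
open scoped BigOperators Polynomial

/-! ## 1. Converse splitting lemma and the exponent bookkeeping -/

/-- A non-zero real polynomial with `card roots = natDegree` has only real complex roots. [folklore] -/
theorem roots_real_of_card_roots_eq_natDegree (p : ℝ[X]) (hp : p ≠ 0)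
    (h : Multiset.card p.roots = p.natDegree) : ∀ z : ℂ, Polynomial.aeval z p = 0 → z.im = 0 := by
  intro z hz
  have hprod := C_leadingCoeff_mul_prod_multiset_X_sub_C h
  rw [← hprod, map_mul, Polynomial.aeval_C] at hz
  have hlc : (algebraMap ℝ ℂ) p.leadingCoeff ≠ 0 := by
    rw [Ne, map_eq_zero_iff _ (algebraMap ℝ ℂ).injective]; exact leadingCoeff_ne_zero.2 hp
  rcases mul_eq_zero.1 hz with h1 | h1
  · exact absurd h1 hlc
  · rw [map_multiset_prod, Multiset.map_map, Multiset.prod_eq_zero_iff, Multiset.mem_map] at h1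
    obtain ⟨r, -, hr⟩ := h1
    rw [Function.comp_apply, map_sub, Polynomial.aeval_X, Polynomial.aeval_C, Complex.coe_algebraMap, sub_eq_zero] at hr
    rw [hr, Complex.ofReal_im]

/-- Exponent bookkeeping of the rescaling `y = s^b`, `z = W s^{3a}`: the monomial `W^{i+l}` of the term `(i,j)`, `l ≤ j`, carries
`s^{e}`, `e = 3ai + l(3a+b) + 3b(j−l) ≤ 3ak`, with equality iff `l = 0` and `j b = a (k − i)`. [folklore] -/
theorem noU3_exponent_le (a b k i j l : ℕ) (h3a : 3 * a < 2 * b) (hl : l ≤ j) (hik : i ≤ k)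
    (hmax : j * b ≤ a * (k - i)) :
    3 * a * i + l * (3 * a + b) + 3 * b * (j - l) ≤ 3 * a * k ∧
      (3 * a * i + l * (3 * a + b) + 3 * b * (j - l) = 3 * a * k ↔ l = 0 ∧ j * b = a * (k - i)) := by
  obtain ⟨j', rfl⟩ := Nat.exists_eq_add_of_le hl
  obtain ⟨k', rfl⟩ := Nat.exists_eq_add_of_le hik
  rw [Nat.add_sub_cancel_left] at hmax ⊢
  rw [Nat.add_sub_cancel_left]
  have h1 : l * (3 * a) ≤ l * (2 * b) := Nat.mul_le_mul_left l h3a.le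
  refine ⟨by nlinarith [hmax, h1], ⟨fun h => ?_, ?_⟩⟩
  · have hl0 : l = 0 := by
      rcases Nat.eq_zero_or_pos l with h0 | hpos
      · exact h0
      · exfalso
        have h2 : l * (3 * a) < l * (2 * b) := Nat.mul_lt_mul_of_pos_left h3a hpos
        nlinarith [hmax, h2, h]
    subst hl0
    refine ⟨rfl, ?_⟩
    nlinarith [hmax, h]
  · rintro ⟨rfl, h⟩
    nlinarith [h]

/-- `(N+1)⁻ᵈ → [d = 0]` along the naturals. [folklore] -/
theorem tendsto_inv_succ_pow (d : ℕ) :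
    Tendsto (fun N : ℕ => (((N : ℝ) + 1)⁻¹) ^ d) atTop (𝓝 (if d = 0 then (1 : ℝ) else 0)) := by
  rcases Nat.eq_zero_or_pos d with h | h
  · subst h; simp only [pow_zero, if_true]; exact tendsto_const_nhds
  · rw [if_neg h.ne']
    have h1 : Tendsto (fun N : ℕ => ((N : ℝ) + 1)⁻¹) atTop (𝓝 0) := by
      simpa only [one_div] using (tendsto_one_div_add_atTop_nhds_zero_nat (𝕜 := ℝ))
    simpa only [zero_pow h.ne'] using h1.pow d

/-! ## 2. The rescaled family `P_s` -/

/-- **Rescaling identity**: `s^{3ak} · P_s(W) = Q_{s^b}(W s^{3a})`, where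
`P_s = Σ_{ij∈S'} Σ_{l ≤ j} c_ij·C(j,l)·3^l·(−4)^{j−l}·s^{−(3ak−e)}·X^{i+l}`. [folklore] -/
theorem rescaled_identity (S' : Finset (ℕ × ℕ)) (c : ℕ × ℕ → ℝ) (k a b : ℕ)
    (h3a : 3 * a < 2 * b)
    (hsupp : ∀ ij ∈ S', ij ≠ (k, 0) → 2 * ij.1 + 3 * ij.2 + 1 ≤ 2 * k)
    (hmax : ∀ ij ∈ S', 1 ≤ ij.2 → ij.2 * b ≤ a * (k - ij.1))
    (s : ℝ) (hs : s ≠ 0) (W : ℂ) :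
    (s : ℂ) ^ (3 * a * k) * Polynomial.aeval W
      (∑ ij ∈ S', ∑ l ∈ Finset.range (ij.2 + 1),
        Polynomial.C (c ij * (ij.2.choose l : ℝ) * 3 ^ l * (-4) ^ (ij.2 - l) *
          (s⁻¹) ^ (3 * a * k - (3 * a * ij.1 + l * (3 * a + b) + 3 * b * (ij.2 - l)))) * X ^ (ij.1 + l)) =
    ∑ ij ∈ S', (c ij : ℂ) * (W * (s : ℂ) ^ (3 * a)) ^ ij.1 *
      (3 * (W * (s : ℂ) ^ (3 * a)) * (((s ^ b : ℝ)) : ℂ) - 4 * (((s ^ b : ℝ)) : ℂ) ^ 3) ^ ij.2 := by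
  rw [map_sum, Finset.mul_sum]
  refine Finset.sum_congr rfl fun ij hij => ?_
  -- exponent bound for this `ij`
  have hik : ij.1 ≤ k := by
    by_cases h : ij = (k, 0)
    · rw [h]
    · have := hsupp ij hij h; omega
  have hmax' : ij.2 * b ≤ a * (k - ij.1) := by
    rcases Nat.eq_zero_or_pos ij.2 with h0 | hpos
    · rw [h0, zero_mul]; exact Nat.zero_le _
    · exact hmax ij hij hpos
  -- expand the right-hand side binomially
  rw [sub_eq_add_neg, add_pow, Finset.mul_sum, map_sum, Finset.mul_sum]
  refine Finset.sum_congr rfl fun l hl => ?_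
  have hlj : l ≤ ij.2 := Nat.lt_succ_iff.1 (Finset.mem_range.1 hl)
  obtain ⟨hle, -⟩ := noU3_exponent_le a b k ij.1 ij.2 l h3a hlj hik hmax'
  set e : ℕ := 3 * a * ij.1 + l * (3 * a + b) + 3 * b * (ij.2 - l) with he
  obtain ⟨d, hd⟩ : ∃ d, 3 * a * k = e + d := ⟨3 * a * k - e, by omega⟩
  have hsC : (s : ℂ) ≠ 0 := Complex.ofReal_ne_zero.2 hs
  rw [hd, Nat.add_sub_cancel_left, map_mul, Polynomial.aeval_C, map_pow, Polynomial.aeval_X, Complex.coe_algebraMap]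
  push_cast
  have hcancel : (s : ℂ) ^ (e + d) * ((s : ℂ)⁻¹) ^ d = (s : ℂ) ^ e := by
    rw [pow_add, mul_assoc, ← mul_pow, mul_inv_cancel₀ hsC, one_pow, mul_one]
  calc (s : ℂ) ^ (e + d) * ((c ij : ℂ) * (ij.2.choose l : ℂ) * 3 ^ l * (-4) ^ (ij.2 - l) * ((s : ℂ)⁻¹) ^ d * W ^ (ij.1 + l))
      = ((s : ℂ) ^ (e + d) * ((s : ℂ)⁻¹) ^ d) * ((c ij : ℂ) * (ij.2.choose l : ℂ) * 3 ^ l * (-4) ^ (ij.2 - l) * W ^ (ij.1 + l)) := by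
        ring
    _ = (s : ℂ) ^ e * ((c ij : ℂ) * (ij.2.choose l : ℂ) * 3 ^ l * (-4) ^ (ij.2 - l) * W ^ (ij.1 + l)) := by rw [hcancel]
    _ = (c ij : ℂ) * (W * (s : ℂ) ^ (3 * a)) ^ ij.1 *
          ((3 * (W * (s : ℂ) ^ (3 * a)) * (s : ℂ) ^ b) ^ l * (-(4 * ((s : ℂ) ^ b) ^ 3)) ^ (ij.2 - l) * (ij.2.choose l : ℂ)) := by
        rw [he]; ring

/-- **Degree of the rescaled family**: `natDegree P_s = k` and the `W^k`-coefficient is `c(k,0)`, for every `s`. [folklore] -/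
theorem natDegree_rescaled (S' : Finset (ℕ × ℕ)) (c : ℕ × ℕ → ℝ) (k a b : ℕ)
    (hk0 : (k, 0) ∈ S') (hc0 : c (k, 0) ≠ 0)
    (hsupp : ∀ ij ∈ S', ij ≠ (k, 0) → 2 * ij.1 + 3 * ij.2 + 1 ≤ 2 * k) (s : ℝ) :
    (∑ ij ∈ S', ∑ l ∈ Finset.range (ij.2 + 1),
        Polynomial.C (c ij * (ij.2.choose l : ℝ) * 3 ^ l * (-4) ^ (ij.2 - l) *
          (s⁻¹) ^ (3 * a * k - (3 * a * ij.1 + l * (3 * a + b) + 3 * b * (ij.2 - l)))) * X ^ (ij.1 + l)).natDegree = k ∧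
    (∑ ij ∈ S', ∑ l ∈ Finset.range (ij.2 + 1),
        Polynomial.C (c ij * (ij.2.choose l : ℝ) * 3 ^ l * (-4) ^ (ij.2 - l) *
          (s⁻¹) ^ (3 * a * k - (3 * a * ij.1 + l * (3 * a + b) + 3 * b * (ij.2 - l)))) * X ^ (ij.1 + l)).coeff k =
      c (k, 0) := by
  -- the `W^k`-coefficient
  have hcoeff : (∑ ij ∈ S', ∑ l ∈ Finset.range (ij.2 + 1),
      Polynomial.C (c ij * (ij.2.choose l : ℝ) * 3 ^ l * (-4) ^ (ij.2 - l) *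
        (s⁻¹) ^ (3 * a * k - (3 * a * ij.1 + l * (3 * a + b) + 3 * b * (ij.2 - l)))) * X ^ (ij.1 + l)).coeff k =
      c (k, 0) := by
    rw [finsetSum_coeff, Finset.sum_eq_single (k, 0)]
    · rw [finsetSum_coeff, Finset.sum_range_one, coeff_C_mul_X_pow, if_pos (by simp)]
      simp
    · intro ij hij hne
      rw [finsetSum_coeff]
      refine Finset.sum_eq_zero fun l hl => ?_
      rw [coeff_C_mul_X_pow, if_neg]
      have h1 := hsupp ij hij hne
      have h2 : l ≤ ij.2 := Nat.lt_succ_iff.1 (Finset.mem_range.1 hl)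
      omega
    · intro h; exact absurd hk0 h
  refine ⟨le_antisymm ?_ (le_natDegree_of_ne_zero (by rw [hcoeff]; exact hc0)), hcoeff⟩
  refine natDegree_sum_le_of_forall_le _ _ fun ij hij => natDegree_sum_le_of_forall_le _ _ fun l hl => ?_
  refine (natDegree_C_mul_X_pow_le _ _).trans ?_
  have h2 : l ≤ ij.2 := Nat.lt_succ_iff.1 (Finset.mem_range.1 hl)
  by_cases h : ij = (k, 0)
  · rw [h] at h2 ⊢; simp only at h2 ⊢; omega
  · have h1 := hsupp ij hij h; omega

/-- **Roots of the rescaled family**: if every `Q_y` (`y` real) has only real complex roots, so does every `P_s`, `s ≠ 0`.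
[folklore] -/
theorem rescaled_roots_real (S' : Finset (ℕ × ℕ)) (c : ℕ × ℕ → ℝ) (k a b : ℕ)
    (h3a : 3 * a < 2 * b)
    (hsupp : ∀ ij ∈ S', ij ≠ (k, 0) → 2 * ij.1 + 3 * ij.2 + 1 ≤ 2 * k)
    (hmax : ∀ ij ∈ S', 1 ≤ ij.2 → ij.2 * b ≤ a * (k - ij.1))
    (hW : ∀ y : ℝ, ∀ z : ℂ,
      (∑ ij ∈ S', (c ij : ℂ) * z ^ ij.1 * (3 * z * (y : ℂ) - 4 * (y : ℂ) ^ 3) ^ ij.2) = 0 → z.im = 0)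
    (s : ℝ) (hs : s ≠ 0) :
    ∀ W : ℂ, Polynomial.aeval W
      (∑ ij ∈ S', ∑ l ∈ Finset.range (ij.2 + 1),
        Polynomial.C (c ij * (ij.2.choose l : ℝ) * 3 ^ l * (-4) ^ (ij.2 - l) *
          (s⁻¹) ^ (3 * a * k - (3 * a * ij.1 + l * (3 * a + b) + 3 * b * (ij.2 - l)))) * X ^ (ij.1 + l)) = 0 →
      W.im = 0 := by
  intro W hW0
  have hid := rescaled_identity S' c k a b h3a hsupp hmax s hs W
  rw [hW0, mul_zero] at hid
  have him := hW (s ^ b) (W * (s : ℂ) ^ (3 * a)) hid.symm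
  rw [← Complex.ofReal_pow, Complex.mul_im, Complex.ofReal_re, Complex.ofReal_im, mul_zero, zero_add] at him
  exact (mul_eq_zero.1 him).resolve_right (pow_ne_zero _ hs)

/-- **Coefficient limits of the rescaled family** along `s = N + 1`: the limit is the top-weight polynomial
`Σ_{j b = a(k−i)} c_ij (−4)^j X^i`. [folklore] -/
theorem tendsto_coeff_rescaled (S' : Finset (ℕ × ℕ)) (c : ℕ × ℕ → ℝ) (k a b : ℕ)
    (h3a : 3 * a < 2 * b)
    (hsupp : ∀ ij ∈ S', ij ≠ (k, 0) → 2 * ij.1 + 3 * ij.2 + 1 ≤ 2 * k)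
    (hmax : ∀ ij ∈ S', 1 ≤ ij.2 → ij.2 * b ≤ a * (k - ij.1)) (n : ℕ) :
    Tendsto (fun N : ℕ => (∑ ij ∈ S', ∑ l ∈ Finset.range (ij.2 + 1),
        Polynomial.C (c ij * (ij.2.choose l : ℝ) * 3 ^ l * (-4) ^ (ij.2 - l) *
          (((N : ℝ) + 1)⁻¹) ^ (3 * a * k - (3 * a * ij.1 + l * (3 * a + b) + 3 * b * (ij.2 - l)))) * X ^ (ij.1 + l)).coeff n)
      atTop (𝓝 ((∑ ij ∈ S', Polynomial.C (if ij.2 * b = a * (k - ij.1) then c ij * (-4) ^ ij.2 else 0) * X ^ ij.1).coeff n)) := by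
  simp_rw [finsetSum_coeff, coeff_C_mul_X_pow]
  -- the limit, written as a double sum
  have hlim : ∀ ij ∈ S', (∑ l ∈ Finset.range (ij.2 + 1),
      (if n = ij.1 + l then c ij * (ij.2.choose l : ℝ) * 3 ^ l * (-4) ^ (ij.2 - l) *
        (if 3 * a * k - (3 * a * ij.1 + l * (3 * a + b) + 3 * b * (ij.2 - l)) = 0 then (1 : ℝ) else 0) else 0)) =
      (if n = ij.1 then (if ij.2 * b = a * (k - ij.1) then c ij * (-4) ^ ij.2 else 0) else 0) := by
    intro ij hij
    have hik : ij.1 ≤ k := by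
      by_cases h : ij = (k, 0)
      · rw [h]
      · have := hsupp ij hij h; omega
    have hmax' : ij.2 * b ≤ a * (k - ij.1) := by
      rcases Nat.eq_zero_or_pos ij.2 with h0 | hpos
      · rw [h0, zero_mul]; exact Nat.zero_le _
      · exact hmax ij hij hpos
    rw [Finset.sum_eq_single 0]
    · obtain ⟨hle, hiff⟩ := noU3_exponent_le a b k ij.1 ij.2 0 h3a (Nat.zero_le _) hik hmax'
      have hcond : (3 * a * k - (3 * a * ij.1 + 0 * (3 * a + b) + 3 * b * (ij.2 - 0)) = 0) ↔
          ij.2 * b = a * (k - ij.1) := by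
        rw [Nat.sub_eq_zero_iff_le]
        constructor
        · intro h; exact (hiff.1 (le_antisymm hle h)).2
        · intro h; exact (hiff.2 ⟨rfl, h⟩).ge
      by_cases hq : ij.2 * b = a * (k - ij.1)
      · rw [if_pos (hcond.2 hq), if_pos hq]
        simp only [add_zero, Nat.choose_zero_right, Nat.cast_one, mul_one, pow_zero, Nat.sub_zero]
      · rw [if_neg (fun h => hq (hcond.1 h)), if_neg hq]
        simp only [mul_zero, ite_self]
    · intro l hl hl0
      have hlj : l ≤ ij.2 := Nat.lt_succ_iff.1 (Finset.mem_range.1 hl)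
      obtain ⟨hle, hiff⟩ := noU3_exponent_le a b k ij.1 ij.2 l h3a hlj hik hmax'
      have hne : 3 * a * k - (3 * a * ij.1 + l * (3 * a + b) + 3 * b * (ij.2 - l)) ≠ 0 := by
        intro h
        rw [Nat.sub_eq_zero_iff_le] at h
        exact hl0 (hiff.1 (le_antisymm hle h)).1
      rw [if_neg hne, mul_zero]
      simp only [ite_self]
    · intro h; exact absurd (Finset.mem_range.2 (Nat.succ_pos _)) h
  rw [← Finset.sum_congr rfl hlim]
  refine tendsto_finsetSum _ fun ij hij => tendsto_finsetSum _ fun l hl => ?_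
  by_cases h : n = ij.1 + l
  · simp only [if_pos h]
    exact (tendsto_inv_succ_pow _).const_mul _
  · simp only [if_neg h]
    exact tendsto_const_nhds

/-- **The top-weight polynomial has only real roots** (the `y → +∞` limit of §1 of the owner's STUB-PLAN for (m9)): by
`realRootedLimit` along the rescaled family `P_{N+1}`. [folklore] -/
theorem topWeight_roots_real (S' : Finset (ℕ × ℕ)) (c : ℕ × ℕ → ℝ) (k a b : ℕ)
    (hk0 : (k, 0) ∈ S') (hc0 : c (k, 0) ≠ 0) (h3a : 3 * a < 2 * b)
    (hsupp : ∀ ij ∈ S', ij ≠ (k, 0) → 2 * ij.1 + 3 * ij.2 + 1 ≤ 2 * k)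
    (hmax : ∀ ij ∈ S', 1 ≤ ij.2 → ij.2 * b ≤ a * (k - ij.1))
    (hW : ∀ y : ℝ, ∀ z : ℂ,
      (∑ ij ∈ S', (c ij : ℂ) * z ^ ij.1 * (3 * z * (y : ℂ) - 4 * (y : ℂ) ^ 3) ^ ij.2) = 0 → z.im = 0) :
    ∀ w : ℂ, (∑ ij ∈ S', (if ij.2 * b = a * (k - ij.1) then (c ij : ℂ) * (-4) ^ ij.2 else 0) * w ^ ij.1) = 0 →
      w.im = 0 := by
  set q : ℝ[X] := ∑ ij ∈ S', Polynomial.C (if ij.2 * b = a * (k - ij.1) then c ij * (-4) ^ ij.2 else 0) * X ^ ij.1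
    with hq
  -- degree and non-vanishing of `q`
  have hqcoeff : q.coeff k = c (k, 0) := by
    rw [hq, finsetSum_coeff, Finset.sum_eq_single (k, 0)]
    · rw [coeff_C_mul_X_pow, if_pos rfl, if_pos (by simp)]; simp
    · intro ij hij hne
      rw [coeff_C_mul_X_pow, if_neg]
      have := hsupp ij hij hne; omega
    · intro h; exact absurd hk0 h
  have hq0 : q ≠ 0 := fun h => hc0 (by rw [← hqcoeff, h, coeff_zero])
  have hqdeg : q.natDegree = k := by
    refine le_antisymm ?_ (le_natDegree_of_ne_zero (by rw [hqcoeff]; exact hc0))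
    rw [hq]
    refine natDegree_sum_le_of_forall_le _ _ fun ij hij => (natDegree_C_mul_X_pow_le _ _).trans ?_
    by_cases h : ij = (k, 0)
    · rw [h]
    · have := hsupp ij hij h; omega
  -- the family `P_{N+1}`
  have hcard : Multiset.card q.roots = k := by
    refine realRootedLimit k (fun N : ℕ => ∑ ij ∈ S', ∑ l ∈ Finset.range (ij.2 + 1),
        Polynomial.C (c ij * (ij.2.choose l : ℝ) * 3 ^ l * (-4) ^ (ij.2 - l) *
          (((N : ℝ) + 1)⁻¹) ^ (3 * a * k - (3 * a * ij.1 + l * (3 * a + b) + 3 * b * (ij.2 - l)))) * X ^ (ij.1 + l))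
      q (fun N => (natDegree_rescaled S' c k a b hk0 hc0 hsupp _).1) hqdeg
      (fun i => tendsto_coeff_rescaled S' c k a b h3a hsupp hmax i) (fun N => ?_)
    have hN : ((N : ℝ) + 1) ≠ 0 := by positivity
    rw [card_roots_eq_natDegree_of_roots_real _ (rescaled_roots_real S' c k a b h3a hsupp hmax hW _ hN),
      (natDegree_rescaled S' c k a b hk0 hc0 hsupp _).1]
  -- hence only real roots
  intro w hw
  refine roots_real_of_card_roots_eq_natDegree q hq0 (by rw [hcard, hqdeg]) w ?_
  rw [hq, map_sum, ← hw]
  refine Finset.sum_congr rfl fun ij _ => ?_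
  rw [map_mul, map_pow, Polynomial.aeval_X, Polynomial.aeval_C, Complex.coe_algebraMap]
  split_ifs <;> push_cast <;> ring

end Summit.QuantumFields.YangMills.Theorems.RationalShortRootRigidity
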